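import Summits.QuantumFields.BalabanUV.Beta.GAN24.CombFreeGaugeLegCharges
import Summits.QuantumFields.BalabanUV.Beta.GAN24.LinT2CoDressed
import Summits.QuantumFields.BalabanUV.Beta.FP.MixVertexLimit

/-!
# `BalabanUV.Beta.GAN24.SecondOrderVertexWeightedCharges` — binder row G-an2-4 ∕ (CONV-C), row (C) at the levels `j ≥ 1`, CONTACT side; Part 22 of
# `GAN24/FourFaceGaugeSectors`: **THE TWO-LEG WEIGHTED CHARGES OF an2's SECOND-ORDER VERTICES `vertex2OfK` AND `mixOfK`** — leaf-06 g47 FILE A's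
# `hasSum_prod_weight_vertexOfK ∕ _vertexOfM` applied TWICE: both column weights come out, the two-leg charge of the bi-table ∕ mixed table stays:
# `Σ_{(u,x)} ω(u,x)·vertex2OfK K N S₂ μ y ν y′ u x a b = Σ_l Σ'_t colH K N μ y l t·Σ_{l′} Σ'_{t′} colH K N ν y′ l′ t′·Σ'_{(u,x)} ω(u,x)·S₂ l t l′ t′ u x a b`,
# `Σ_{(u,x)} ω(u,x)·mixOfK K N M₂ μ y ν y′ u x a b = Σ_l Σ'_t colH K N μ y l t·Σ_ρ Σ'_w colM K N ν y′ ρ w·Σ'_{(u,x)} ω(u,x)·M₂ l t ρ w u x a b`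

NOT IN PRINT; OUR BOOKKEEPING (G-an2-4 crux team (2), leaf prover `b2b-balaban-gan24-formalise-leaf-02`, gen 66).  WHY.  The order-2 leg tower for the CONTACT values of (C)_{j≥1}
(memo `HOME/…/leaf-02/g66/CT-VALUES-PLAN-v0.md` §3 ∕ §5) unfolds, word by word, the interior `Y = dM_b G_j dM_{b′} + dM_{b′} G_j dM_b − WrecAt j b b′` of Part 21's
`hasSum_prod_gaugeLeg_K3OfK` against two-leg weights; `WrecAt j = ½(W2OfK + swap)` with `W2OfK = vertex2OfK (T2RecAt j) + mixOfK (M2Of mixFF j) + mixOfK∘swap + dM (K2OfK …) …`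
(`SecondOrderResponse` :352).  FILE A has the one-column letters (`vertexOfK`, `vertexOfM`); the `dM (K2OfK …)` word is FILE A's with `K := K2OfK …`; THIS FILE supplies the two
missing two-column ones, generic in `(K, S₂, M₂, ω)`: after them the charge sits on the LEVEL-`j` bi-table `S₂ = T2RecAt j` (⇒ Part 21 one level down = the INDUCTION of the tower)
resp. on the mixed table `M₂ = M2Of mixFF j` (an1's letters).  Nothing of the tower's values is computed here.

WHAT ([folklore] `tsum`–`Finset` exchange BY NAME over FILE A `CombFreeGaugeLegCharges.hasSum_prod_weight_vertexOfK ∕ _vertexOfM`, leaf-03's `LinT2CoDressed.locStencil_slice ∕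
locStencil_vertexOfK_slice`, d1-p3's `FP/MixVertexLimit.locStencil_innerMix`; 0 `def`, 0 cited facts, 0 `def … : Prop`, 0 sorry; common rate `m` for `K` and the tables —
weaken beforehand):
* §1 `vertexFamily_slice_of_locStencilFM` (a `LocStencilFM` slice `M₂ κ u` is a `VertexFamily` at half the rate, re-anchored from `u` to `N•w`);
* §2 **`hasSum_prod_weight_vertex2OfK`**; §3 **`hasSum_prod_weight_mixOfK`** (the displayed identities, as `HasSum` over `Site × Site`, bounded `ω`).
HONEST FRAMING (cell contract, verbatim): «discharging `BetaPertH` makes Bałaban's UV stability UNCONDITIONAL — a real constructive-QFT result; it is NOT the continuum limit and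
NOT the Clay problem.»  HONEST DEPENDENCY (verbatim): «continuum YM on T⁴ ⇐ BetaPertH ∧ nine spine estimates (0/9 proved); BetaPertH ⇐ (D1) ∧ (D4) ∧ CAP+tail; G-an2-4
gates asym, D1 and NE2/3/4.»  Bookkeeping only; NO Ward content; NOTHING of (C) at j ≥ 1 ∕ (C)sym ∕ (Q-L) ∕ «T2Shape» ∕ «T2Drift» ∕ (hW, hWall) discharged; NEVER «G-an2-4 closed»
as (CONV-C); NOT D1, NOT `BetaPertH`, NOT continuum, NOT Clay.  2026-08-23; no existing file touched.
-/

noncomputable section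

open Finset
open scoped BigOperators
open Literature.MathematicalPhysics.QuantumFieldTheory
open Literature.MathematicalPhysics.QuantumFieldTheory.Balaban1983to89
open Literature.MathematicalPhysics.QuantumFieldTheory.Balaban1983to89.Beta
open B12Sec2to5 (l1 l1_nonneg)
open ExpKernelCalculus (Site MKer Decays BiLoc VertexFamily Zl l1_sub_triangle)
open OneStepResolventKernel (Fib LocStencil)
open OneStepKernelFamily (colH vertexOfK)
open SecondOrderResponse (colM vertexOfM vertex2OfK mixOfK LocStencilFM)
open BalabanCompositeJets (LocStencil₂)
open Summit.QuantumFields.BalabanUV.Beta.GAN24.CombFreeGaugeLegCharges (hasSum_prod_weight_vertexOfK hasSum_prod_weight_vertexOfM)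
open Summit.QuantumFields.BalabanUV.Beta.GAN24.LinT2CoDressed (locStencil_slice locStencil_vertexOfK_slice)
open Summit.QuantumFields.BalabanUV.Beta.FP.MixVertexLimit (locStencil_innerMix)

namespace Summit.QuantumFields.BalabanUV.Beta.GAN24.SecondOrderVertexWeightedCharges

variable {d : ℕ} {N : ℕ}

/-! ## §1 A `LocStencilFM` slice as a vertex family -/

/-- [folklore] **A MIXED-TABLE SLICE IS A VERTEX FAMILY AT HALF THE RATE**: `LocStencilFM N M₂ C₂ m`, `0 ≤ m` ⇒ for every field slot `(κ, u)`,
`VertexFamily (M₂ κ u) N C₂ (m/2)` — the bi-localisation at `u` with the separation weight `e^{−m|u − N•w|}` re-anchored at the coarse point `N•w` (triangle inequality). -/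
theorem vertexFamily_slice_of_locStencilFM {M₂ : Fin (d + 1) → (Fin (d + 1) → ℤ) → Fin (d + 1) → (Fin (d + 1) → ℤ) → MKer (d + 1) (Fib d)} {C₂ m : ℝ}
    (hM₂ : LocStencilFM N M₂ C₂ m) (hm : 0 ≤ m) (κ : Fin (d + 1)) (u : Fin (d + 1) → ℤ) : VertexFamily (M₂ κ u) N C₂ (m / 2) := by
  have hC₂ := hM₂.nonneg
  intro ρ w x z a b
  refine (hM₂ κ u ρ w x z a b).trans ?_
  rw [mul_assoc, ← Real.exp_add]
  refine mul_le_mul_of_nonneg_left (Real.exp_le_exp.2 ?_) hC₂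
  have tx : l1 (x - (N : ℤ) • w) ≤ l1 (x - u) + l1 (u - (N : ℤ) • w) := l1_sub_triangle x u ((N : ℤ) • w)
  have tz : l1 (z - (N : ℤ) • w) ≤ l1 (z - u) + l1 (u - (N : ℤ) • w) := l1_sub_triangle z u ((N : ℤ) • w)
  have h0 := l1_nonneg (x - u)
  have h1 := l1_nonneg (z - u)
  have h2 := l1_nonneg (u - (N : ℤ) • w)
  have h3 := mul_le_mul_of_nonneg_left (add_le_add tx tz) (by linarith : (0 : ℝ) ≤ m / 2)
  nlinarith [h3, mul_nonneg hm h0, mul_nonneg hm h1, mul_nonneg hm h2]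

/-! ## §2 The bi-vertex `vertex2OfK` against a bounded two-leg weight -/

/-- NOT IN PRINT; OUR BOOKKEEPING.  **THE TWO-LEG WEIGHTED CHARGE OF THE BI-VERTEX** (`K` decaying at rate `m > 0`, `LocStencil₂ S₂ C₂ m`, `|ω| ≤ B`, `1 ≤ N`):
`Σ_{(u,x)} ω(u,x)·vertex2OfK K N S₂ μ y ν y′ u x a b = Σ_l Σ'_t colH K N μ y l t · Σ_{l′} Σ'_{t′} colH K N ν y′ l′ t′ · Σ'_{(u,x)} ω(u,x)·S₂ l t l′ t′ u x a b` — FILE A's one-column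
letter on the outer column (the inner vertices are a local stencil family, `locStencil_vertexOfK_slice`), then on the inner column slice by slice (`locStencil_slice`, half rate). -/
theorem hasSum_prod_weight_vertex2OfK [NeZero N] {K : MKer (d + 1) (Fib d)} {C m : ℝ} (hK : Decays K C m) (hm : 0 < m)
    {S₂ : Fin (d + 1) → (Fin (d + 1) → ℤ) → Fin (d + 1) → (Fin (d + 1) → ℤ) → MKer (d + 1) (Fib d)} {C₂ : ℝ} (hS₂ : LocStencil₂ S₂ C₂ m)
    {ω : Site (d + 1) × Site (d + 1) → ℝ} {B : ℝ} (hω : ∀ xz, |ω xz| ≤ B)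
    (μ : Fin (d + 1)) (y : Site (d + 1)) (ν : Fin (d + 1)) (y' : Site (d + 1)) (a b : Fib d) :
    HasSum (fun ux : Site (d + 1) × Site (d + 1) => ω ux * vertex2OfK K N S₂ μ y ν y' ux.1 ux.2 a b)
      (∑ l, ∑' t, colH K N μ y l t * ∑ l', ∑' t', colH K N ν y' l' t' * ∑' ux : Site (d + 1) × Site (d + 1), ω ux * S₂ l t l' t' ux.1 ux.2 a b) := by
  have hC : 0 ≤ C := hK.nonneg (Sum.inl 0)
  have h1 := hasSum_prod_weight_vertexOfK (N := N) hK hC (locStencil_vertexOfK_slice (N := N) hK hm hS₂ ν y') hm le_rfl hω μ y a b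
  have e : ∀ (l : Fin (d + 1)) (t : Site (d + 1)), (∑' ux : Site (d + 1) × Site (d + 1), ω ux * vertexOfK K N (S₂ l t) ν y' ux.1 ux.2 a b)
      = ∑ l', ∑' t', colH K N ν y' l' t' * ∑' ux : Site (d + 1) × Site (d + 1), ω ux * S₂ l t l' t' ux.1 ux.2 a b := fun l t =>
    (hasSum_prod_weight_vertexOfK (N := N) hK hC (locStencil_slice hS₂ hm.le l t) (half_pos hm) (half_le_self hm.le) hω ν y' a b).tsum_eq
  simp only [e] at h1
  exact h1

/-! ## §3 The mixed bi-vertex `mixOfK` against a bounded two-leg weight -/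

/-- NOT IN PRINT; OUR BOOKKEEPING.  **THE TWO-LEG WEIGHTED CHARGE OF THE MIXED BI-VERTEX** (`K` decaying at rate `m > 0`, `LocStencilFM N M₂ C₂ m`, `|ω| ≤ B`, `1 ≤ N`):
`Σ_{(u,x)} ω(u,x)·mixOfK K N M₂ μ y ν y′ u x a b = Σ_l Σ'_t colH K N μ y l t · Σ_ρ Σ'_w colM K N ν y′ ρ w · Σ'_{(u,x)} ω(u,x)·M₂ l t ρ w u x a b` — FILE A's field-column letter
outside (inner family local by `locStencil_innerMix`), its multiplier-column letter inside (the slice is a vertex family, §1). -/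
theorem hasSum_prod_weight_mixOfK [NeZero N] {K : MKer (d + 1) (Fib d)} {C m : ℝ} (hK : Decays K C m) (hm : 0 < m)
    {M₂ : Fin (d + 1) → (Fin (d + 1) → ℤ) → Fin (d + 1) → (Fin (d + 1) → ℤ) → MKer (d + 1) (Fib d)} {C₂ : ℝ} (hM₂ : LocStencilFM N M₂ C₂ m)
    {ω : Site (d + 1) × Site (d + 1) → ℝ} {B : ℝ} (hω : ∀ xz, |ω xz| ≤ B)
    (μ : Fin (d + 1)) (y : Site (d + 1)) (ν : Fin (d + 1)) (y' : Site (d + 1)) (a b : Fib d) :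
    HasSum (fun ux : Site (d + 1) × Site (d + 1) => ω ux * mixOfK K N M₂ μ y ν y' ux.1 ux.2 a b)
      (∑ l, ∑' t, colH K N μ y l t * ∑ ρ, ∑' w, colM K N ν y' ρ w * ∑' ux : Site (d + 1) × Site (d + 1), ω ux * M₂ l t ρ w ux.1 ux.2 a b) := by
  have hC : 0 ≤ C := hK.nonneg (Sum.inl 0)
  have hN : 1 ≤ N := Nat.one_le_iff_ne_zero.2 (NeZero.ne N)
  have h1 := hasSum_prod_weight_vertexOfK (N := N) hK hC (locStencil_innerMix (N := N) hK hm hM₂ ν y') hm le_rfl hω μ y a b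
  have e : ∀ (l : Fin (d + 1)) (t : Site (d + 1)), (∑' ux : Site (d + 1) × Site (d + 1), ω ux * vertexOfM K N (M₂ l t) ν y' ux.1 ux.2 a b)
      = ∑ ρ, ∑' w, colM K N ν y' ρ w * ∑' ux : Site (d + 1) × Site (d + 1), ω ux * M₂ l t ρ w ux.1 ux.2 a b := fun l t =>
    (hasSum_prod_weight_vertexOfM (N := N) hN hK hC (vertexFamily_slice_of_locStencilFM hM₂ hm.le l t) (half_pos hm) (half_le_self hm.le) hω ν y' a b).tsum_eq
  simp only [e] at h1
  exact h1

end Summit.QuantumFields.BalabanUV.Beta.GAN24.SecondOrderVertexWeightedCharges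

end
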